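import Summits.ValiantsHypothesis.ValiantsHypothesis.Theorems.KPlusLogSqLawTropicalBBoardLawNoReset
import Summits.ValiantsHypothesis.ValiantsHypothesis.Theorems.KPlusLogSqLawTropicalCycleMonotone

/-!
# Route «KPlusLogSqLaw», crux `TropicalB` (stmt-ValiantsHypothesis-19771) — the LOW-ORBIT LAW and the RECTANGLE SIEVE:
# on an exchange orbit carrying only the two low classes, a later term has strictly more cells of the dearer one

HONEST FRAMING.  Fourth sequel of `…TropicalBBoardLaw` (seat val-sym-trop-p3 g18, cell `pub-symmetroid`, 2026-08-29; `--supports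
stmt-ValiantsHypothesis-19771 --as helper`).  A STRUCTURE law for dominant chains of an ARBITRARY design — the tree's cyclewise monotonicity
(`sum_d_lt_of_isDominant_invariant`, …TropicalCycleMonotone, conjb-2 g4 / val-sym-trop-p4 g2) read through the two-class slope formula
`BoardLaw.sl_eq_of_two` (…TropicalBBoardLawNoReset).  It is the kernel form of the SIEVE that kills candidate cubic skeletons for the cell's
`K = 4` fork (seat memo HOME/val-sym-trop-p3/g18/K4-TELESCOPE-g18.md §3.3–3.4: «reset rectangles»).  Nothing here bounds `TropicalB` in its window;
nothing bears on `WeakLifting`, DoorA26 / DoorA34, `MatrixDescartes` (stmt-ValiantsHypothesis-18050) or VP ≠ VNP.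

* `BoardLaw.card_low_lt_of_invariant` — **LOW-ORBIT LAW**: if `p j` (earlier), `p k` (later) are chain terms, `O` is a column set invariant
  under `σ_j⁻¹ σ_k` (a union of exchange orbits) on which both carry only `a, b` (`d a < d b`) and on which they differ, then
  `#{i ∈ O | λ_j i = b} < #{i ∈ O | λ_k i = b}` — independently of what happens off `O` (high cells may move elsewhere).
* `BoardLaw.rectangle_sieve` — the case `#O = 2`: if `p j ∋ (r, x), (r', y)` and `p k ∋ (r', x), (r, y)` (`x ≠ y`), all four cells of class
  `a` or `b`, then `p k` has strictly more `b`-cells on `{x, y}` than `p j`.  In words: a later term never places an `{a,a}` rectangle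
  against an earlier `{a,b}` pair, nor an `{a,b}` rectangle against an earlier `{b,b}` pair — the exchange-law test that every skeleton
  generator of the lineage runs pair by pair (tools/pcm.py), now citable by name.

READING (located, nothing claimed): with `…BoardLawNoReset` (complementary cells standing still ⇒ the low digit only rises) this is why a
phase architecture must give every later phase FRESH rows for its low cells (SHIFT-THREE) or slide a high cell through every step (mountain);
both spend a private incidence per step, hence `O(m²)`.  [this cell]
-/

set_option linter.dupNamespace false
set_option autoImplicit false

namespace Summit.ValiantsHypothesis.ValiantsHypothesis.Theorems.KPlusLogSqLaw

open Summit.ValiantsHypothesis.ValiantsHypothesis.Theorems.MatrixDescartes.Negative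
open Summit.ValiantsHypothesis.ValiantsHypothesis.Theorems.LacunarySymmetroidMatrixDescartes
open scoped BigOperators
open Finset

namespace BoardLaw

variable {m K : ℕ}

section Chain

variable (d : Fin K → ℕ) (v ε : Fin m → Fin m → Fin K → ℤ) {n : ℕ} (θ : Fin (n + 1) → ℤ)
  (p : Fin (n + 1) → Equiv.Perm (Fin m) × (Fin m → Fin K))

/-- **LOW-ORBIT LAW.**  Let `p j` (earlier) and `p k` (later) be terms of a dominant chain and `O` a set of columns invariant under the quotient
permutation `σ_j⁻¹ σ_k` (a union of exchange orbits) on which BOTH terms carry only the classes `a, b` with `d a < d b`, and on which they differ.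
Then the number of `b`-columns in `O` strictly RISES from `p j` to `p k` — whatever happens off `O` (the tree's cyclewise monotonicity
`sum_d_lt_of_isDominant_invariant` read through `BoardLaw.sl_eq_of_two`).  For `#O = 2` this is the RECTANGLE SIEVE: a later term never carries two
`a`-cells in rectangle position against an earlier `{a, b}`-pair, and never an `{a,b}`-pair against an earlier `b,b`. [this cell] -/
theorem card_low_lt_of_invariant (hθ : StrictMono θ) (hdom : ∀ k, IsDominant d v ε (θ k) (p k))
    {j k : Fin (n + 1)} (hjk : j < k) {a b : Fin K} (hab : d a < d b) (O : Finset (Fin m))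
    (hO : ∀ i, ((p j).1⁻¹ * (p k).1) i ∈ O ↔ i ∈ O)
    (hlowj : ∀ i ∈ O, (p j).2 i = a ∨ (p j).2 i = b) (hlowk : ∀ i ∈ O, (p k).2 i = a ∨ (p k).2 i = b)
    (hdiff : ∃ i ∈ O, (p j).1 i ≠ (p k).1 i ∨ (p j).2 i ≠ (p k).2 i) :
    (O.filter fun i => (p j).2 i = b).card < (O.filter fun i => (p k).2 i = b).card := by
  classical
  have hj : IsDominant d v ε (θ j) ((p j).1, (p j).2) := hdom j
  have hk : IsDominant d v ε (θ k) ((p k).1, (p k).2) := hdom k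
  have hmass := sum_d_lt_of_isDominant_invariant d v ε (hθ hjk) hj hk O hO hdiff
  have ej : ∑ i ∈ O, (d ((p j).2 i) : ℤ) = IntervalOpt.sl d O (p j) := rfl
  have ek : ∑ i ∈ O, (d ((p k).2 i) : ℤ) = IntervalOpt.sl d O (p k) := rfl
  rw [ej, ek, sl_eq_of_two d a b O (p j) hlowj, sl_eq_of_two d a b O (p k) hlowk] at hmass
  have hxj : ((O.filter fun i => (p j).2 i = b).card : ℤ) ≤ O.card := by exact_mod_cast card_le_card (filter_subset _ _)
  have hxk : ((O.filter fun i => (p k).2 i = b).card : ℤ) ≤ O.card := by exact_mod_cast card_le_card (filter_subset _ _)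
  have hda : (d a : ℤ) < d b := by exact_mod_cast hab
  by_contra hcon
  push Not at hcon
  have hcon' : ((O.filter fun i => (p k).2 i = b).card : ℤ) ≤ (O.filter fun i => (p j).2 i = b).card := by exact_mod_cast hcon
  nlinarith

/-- **RECTANGLE SIEVE** (the case `#O = 2`, spelled out).  If an earlier term `p j` carries the cells `(r, x), (r', y)` and a later term `p k` the
cells `(r', x), (r, y)` on two columns `x ≠ y` (a 2-orbit of the quotient), all four of classes `a` or `b` with `d a < d b`, then `p k` has strictly
more `b`-cells among `{x, y}` than `p j`. [this cell] -/
theorem rectangle_sieve (hθ : StrictMono θ) (hdom : ∀ k, IsDominant d v ε (θ k) (p k))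
    {j k : Fin (n + 1)} (hjk : j < k) {a b : Fin K} (hab : d a < d b) {x y : Fin m} (hxy : x ≠ y)
    (hrx : (p k).1 x = (p j).1 y) (hry : (p k).1 y = (p j).1 x)
    (hjx : (p j).2 x = a ∨ (p j).2 x = b) (hjy : (p j).2 y = a ∨ (p j).2 y = b)
    (hkx : (p k).2 x = a ∨ (p k).2 x = b) (hky : (p k).2 y = a ∨ (p k).2 y = b) :
    (({x, y} : Finset (Fin m)).filter fun i => (p j).2 i = b).card <
      (({x, y} : Finset (Fin m)).filter fun i => (p k).2 i = b).card := by
  classical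
  refine card_low_lt_of_invariant d v ε θ p hθ hdom hjk hab {x, y} ?_ ?_ ?_ ?_
  · -- `{x, y}` is invariant under `σ_j⁻¹ σ_k`: it swaps `x` and `y`
    have qx : ((p j).1⁻¹ * (p k).1) x = y := by
      rw [Equiv.Perm.mul_apply, hrx]; simp
    have qy : ((p j).1⁻¹ * (p k).1) y = x := by
      rw [Equiv.Perm.mul_apply, hry]; simp
    intro i
    simp only [mem_insert, mem_singleton]
    constructor
    · intro h
      rcases h with h | h
      · -- q i = x ⇒ i = y
        right
        have := congrArg ((p j).1⁻¹ * (p k).1).symm h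
        rw [Equiv.symm_apply_apply] at this
        rw [this, ← qy, Equiv.symm_apply_apply]
      · left
        have := congrArg ((p j).1⁻¹ * (p k).1).symm h
        rw [Equiv.symm_apply_apply] at this
        rw [this, ← qx, Equiv.symm_apply_apply]
    · intro h
      rcases h with rfl | rfl
      · right; exact qx
      · left; exact qy
  · intro i hi
    rcases mem_insert.1 hi with rfl | hi
    · exact hjx
    · rw [mem_singleton.1 hi]; exact hjy
  · intro i hi
    rcases mem_insert.1 hi with rfl | hi
    · exact hkx
    · rw [mem_singleton.1 hi]; exact hky
  · refine ⟨x, mem_insert_self _ _, Or.inl ?_⟩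
    intro h
    -- `σ_j x = σ_k x = σ_j y` contradicts injectivity and `x ≠ y`
    exact hxy ((p j).1.injective (h.trans hrx))

end Chain

end BoardLaw

end Summit.ValiantsHypothesis.ValiantsHypothesis.Theorems.KPlusLogSqLaw
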